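import Summits.HodgeConjecture.HodgeConjecture.Theorems.F0P6aDatumOfInputsDefs
import Summits.HodgeConjecture.HodgeConjecture.Theorems.F0P6aCanonicalLineTransfer
import Summits.HodgeConjecture.HodgeConjecture.Theorems.F0P6aLineSpecialisation
import Summits.HodgeConjecture.HodgeConjecture.Theorems.F0P6aStubFROBCover
import HarnessLib
import HarnessLib.Audit.LibrarySuggestionsDenyListCruxes
import Summits.HodgeConjecture.HodgeConjecture.Theorems.F0P6aStubFROBRoofGeoWiring
import Summits.HodgeConjecture.HodgeConjecture.Theorems.F0P6aStubFROBQuotWD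

/-!
# `F0P6aStubFROBStubs` — ★ RE-HOME of the crux workfile `Lines/F0_P6a_StubFROB.lean` (tree ED. 5 sha16 f9174234eccff5e5, 522 l., 16 declaration commands, code-`sorry`-free), PART 1 of 3 («M-150j» EARLY SPLIT, LEAD F0P6-plan (g7) 03:40Z 09-03 ∕ dealer LA3-plan (g6): this prefix has NO reader of ★ `Theorems.F0P6aStubRHO1` and files ahead of it)

This `Theorems/` module is the TREE BYTES of that workfile with the NAMESPACE KEPT, so every fully-qualified name is UNCHANGED; only this module docstring is re-headed,
the `Lines` imports are switched to their ★ re-homed twins — `Lines.F0_P6a_DatumOfInputs` → ★ `Theorems.F0P6aDatumOfInputsDefs`; `Lines.F0_P6a_LineSpecialisation` → ★ `Theorems.F0P6aLineSpecialisation`; `Lines.F0_P6a_StubFROBCover` → ★ `Theorems.F0P6aStubFROBCover`; `Lines.F0_P6a_StubFROBRoofGeoWiring` → ★ `Theorems.F0P6aStubFROBRoofGeoWiring`; `Lines.F0_P6a_StubFROBQuotWD` → ★ `Theorems.F0P6aStubFROBQuotWD`; `Lines.F0_P6a_StubRHO1` → ★ `Theorems.F0P6aStubRHO1` (that one import rides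 PART 2 `Theorems/F0P6aStubFROBCanSP.lean`, home of its first reader `stub_QUOTWD`; not imported here) — and the audit carrier `LibrarySuggestionsDenyListCruxes` is CARRIED on this root part (bare import, LEAD «M-142d» (1) rule «P-κ»; parts 2…n inherit it transitively)
Why a re-home: a `Theorems/` file cannot import a `Lines/` workfile (F0P6-ref1 o-6), and closing stmt-HodgeConjecture-24832 `--as proved --by <Theorems decl>` at rung 0 needs the
sorry-free `Lines` chain behind the gate (RE-HOME TABLE v1.7, LA7-plan (g7); PLAN «L3 cone RE-HOME» v1, LA3-plan (g5); LEAD F0P6-plan (g5) «M-140» (1)∕(4), 2026-09-02).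
SIZE LINT (`Theorems/` files with proofs ≤ 400 l.): the workfile is cut into 3 consecutive parts `F0P6aStubFROBStubs` → `F0P6aStubFROBCanSP` → `F0P6aStubFROB`; this is PART 1 (tree lines :1–:300, less the two `dedup.landed` cuts [d]∕[d″] marked in place below); each later part imports the previous one and re-opens the scopes open at its cut with their `variable`∕`open`∕`set_option` lines replayed verbatim; the LAST part `F0P6aStubFROB` is the module the `Lines/` shim and consumers import.
After the chain is ★ the `Lines` workfile becomes a one-import SHIM of `F0P6aStubFROB` (a `Lines/` write, batched per cone on the LEAD՚s word), so no environment holds two copies (NO-CROSS-IMPORT).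
It asserts nothing beyond what the workfile already proves.  HC_CM is proved only modulo the 7 printed citations (2 remaining: hLiu418 = stmt-HodgeConjecture-24832, h413 = stmt-HodgeConjecture-24833) until rung 0 closes; a re-home is count-neutral.

## Original module docstring (verbatim)
# ED. 5 (CAND v7, LA3-plan (g3) PEN, lineage LA3-p01 (g3) v2 f9141f5e; DEAL 47 (b) ∕ 52 ∕ 53″; LEAD «M-120» RUNG C; = ED. 4 269ccf19 + THREE import lines (W6 leaflet `Lines/F0_P6a_StubFROBQuotWD.lean` ED. 1 d650a8dd +
# (W4b) `Lines/F0_P6a_StubRHO1.lean` := w4b6 ce86702e, LA1-p01 (g4) pen, ns `…F0P6aLineSpecialisation` + the «M-119b» carrier `HarnessLib.Audit.LibrarySuggestionsDenyListCruxes`) + ONE linter line + `stub_QUOTWD` PAID BY TYPE through (W6″):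
# `:= …F0P6aStubFROBQuotWD.quotwd_of_exists_quotLegReduction I 𝔡 quotΩ translΩ _hhecke _hroof _hroof₂ 𝔯 _hunit _hKc _hdisj (…Cruxes.HLiu418.F0P6aLineSpecialisation.exists_quotLegReduction I)` (the (ρ1𝒞) head; token pair
# {module `…Lines.F0_P6a_StubRHO1`, FQN `…F0P6aLineSpecialisation.exists_quotLegReduction`} fixed by F0P6-lit1 P6L-404 ∕ chain cert LA3-p02 (g4) 76454972 TRIO 0 sorry); every ED. 4 statement byte-frozen;
# head∕junction unchanged.  Sockets now = ∅ (expected sorries 0); L3 debt {`stub_QUOTWD`} ↦ ∅.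
# ED. 4 (LA3-plan (g2) PEN; RULE 39∕40∕41 (α); LEAD «M-98» (1) JOINT {⑧, ⑨}; = ED. 3 4f35c0d6 + ONE import (W5b `Lines/F0_P6a_StubFROBRoofGeoWiring.lean` ED. 1 46cdc102588d6598) + `stub_ROOFGEO` PAID
# `:= roofgeo_closed_of_sigma … (fun y => ⟨(isoGenericOf_inv I y).trans rfl, (isoSpecialOf_inv I y).trans rfl⟩) (frobIdealOf 𝔞 w) (fun σ hσ gam hγ => frobIdealOf_mul_eq 𝔞 w (_hdiv σ hσ gam hγ))`
# (W5b HEAD″ LA3-p03 (g4); the (F1) identities by LS leaflet ED. 3 (F1-SEAL) d6354130); every ED. 3 statement byte-frozen; head∕junction unchanged.  Sockets now = {`stub_QUOTWD`} (expected sorries 1);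
# L3 debt {`stub_QUOTWD`, `stub_ROOFGEO`} ↦ {`stub_QUOTWD`} (L2-fed: W6 leaflet `Lines/F0_P6a_StubFROBQuotWD.lean` + `StubRHO1`, leaf ED. 5).
# ED. 3 «STATE-2» (LA3-plan (g2) PEN; LEAD heir F0P6-plan (g4) «M-74» (v) 07:03:19Z: two NAMED sockets beat one opaque; = ED. 2 36299d7d + ONE import (LS leaflet ED. 2 70f3d2bb)
# + ONE `open … (spGeoOf canonicalLine_spGeoOf natCard_lineOf_eq_succ)` + the ADD-ONLY block `stub_QUOTWD` (sorry; L2-fed (ρ2)) ∕ `stub_CANSP` (PAID: `canSP_of_laws`) ∕ `roof0_of_cansp_geo`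
# (PAID) ∕ `stub_ROOFGEO` (sorry; road (γ)∕(R3)) + `stub_ROOF0` PAID `:= roof0_of_cansp_geo … (stub_CANSP …) (stub_ROOFGEO …)`; every ED. 2 statement byte-frozen; head∕junction unchanged).
# Sockets now = {`stub_QUOTWD`, `stub_ROOFGEO`} (expected sorries 2); L3 debt {`stub_ROOF0`} ↦ {`stub_QUOTWD`, `stub_ROOFGEO`}.
# HC_CM is proved only modulo the 7 printed citations (2 remaining: hLiu418 = stmt-HodgeConjecture-24832, h413 = stmt-HodgeConjecture-24833) until rung 0 closes; count-neutral.

# ED. 2 (LA3-plan (g2) PEN by rights, LEAD heir F0P6-plan (g3) word (b) 05:51:37Z; = ED. 1 9553d5e2 + ONE import + ONE body + ONE linter option): socket `stub_COV0` PAID — `stub_COV0 I := F0P6aStubFROBCover.cov0_of_inputs I`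
# (COV0 Lines leaflet `Cruxes/HLiu418/Lines/F0_P6a_StubFROBCover.lean` ED. 1 c25aa225, sorry-free, TRIO; author LA3-p02 (g0) road (δ) tail∕head∕glue + LA3-p01 (g2) (ν8k) seam ★ p849382).
# Every statement byte-frozen (sockets `stub_COV0`, `stub_ROOF0`, head `stubFROB_of_parts`, junction `example`); sockets now = {`stub_ROOF0`} (expected sorries 1); §CanonicalLine dormant until STATE 2.
# HC_CM is proved only modulo the 7 printed citations (2 remaining: hLiu418 = stmt-HodgeConjecture-24832, h413 = stmt-HodgeConjecture-24833) until rung 0 closes; count-neutral.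

# v5 STATE 1 (A-p03 (g31) PEN; = v5pre a524ebee ⊕ LA3-plan co-pen v5a 97185995 moves (1)–(3); builds only over the spine ED. 4 cone «M-58»):
# (1) `FrobPin₀`.2 BY NAME `FrobKernelBanal₀ …`; (2) residual socket `stub_COV0` (the (cov) conjunct at the spine's twist data; payer LA3-p02); (3) `stub_TWISTCOVER0` is a THEOREM
# (spine rows + `stub_COV0`).  Sockets = {`stub_COV0`, `stub_ROOF0`}; §CanonicalLine dormant (sorry-free) until STATE 2 (LS leaflet BUILT: split `stub_ROOF0` ↦ {`stub_ROOFGEO`, `stub_CANSP`}).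
# v5-pre (A-p03 (g31) PEN, HOME-only REHEARSAL over v4b 09ed9cda0de4f83a; NOT the line of record): v4b VERBATIM in the pen՚s namespace `…F0P6aStubFROB`
# + §CanonicalLine = the D-line-currency GLUE of the v5 split `stub_ROOF0` ↦ {`stub_ROOFGEO`, `stub_CANSP`}: `two_le_pChar_pow_fDeg` (temporary, the LS leaflet §2 names it),
# `eq_kerFOf_or_isEtaleOf` (dichotomy at the dock rows, ★ (K-b)), `subOf_eq_of_isEtaleOf` (étale member unique, ★ p848314 §2 + `hpts₀`), and the REHEARSAL
# `canSP_of_laws` = `stub_CANSP`'s statement with L2's three feeds (`spGeo`, `hcan₂`, `hwd₂`, `hcardL` — LS leaflet `Lines/F0_P6a_LineSpecialisation.lean` §1–§3,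
# LA2-plan deal 02:54:37Z) as EXPLICIT BINDERS, proved by ONE call of ★ p848314 `canonicalLine_transfer_of_red_quotΩ`.  When the leaflet is BUILT, v5 := this file with
# `import …Lines.F0_P6a_LineSpecialisation`, `stub_CANSP := canSP_of_laws … (spGeoOf I 𝔡) (canonicalLine_spGeoOf …) (red₀Of_quotΩ_eq_of_spGeoOf_eq …) (natCard_lineOf_eq_succ …)`
# (sorry-free) and `stub_ROOFGEO` = `stub_ROOF0` with the hypothesis `𝔯.spec.sp y L = kerFOf …` replaced by `spGeoOf I 𝔡 y L = kerFOf …` (LA3-p01's road).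
# HC_CM is proved only modulo the 7 printed citations (2 remaining: hLiu418 24832, h413 24833) until rung 0 closes; HOME-only, nothing registered, count-neutral.

# v4b (LA3-plan (g0) co-pen DELTA over A-p03 (g30) v4 06386a3098ba0eae; A-p03's tokens win, LEAD rules) — «Q-ROOF-w»: THREAD THE NORM EQUATION THROUGH THE ∃

v4 VERBATIM + ONE unguarded conjunct (ns) `∀ γ, Ideal.span {((𝔫 γ : ℕ) : 𝓞 F)} = 𝔞 γ * (IsCMField.complexConj F) • 𝔞 γ` as the LAST output of `stub_TWISTCOVER0` (paid by projection
`I.twistNorm_spec`, spine ED. 3 :246, zero cost) and as the LAST binder `_hspec` of `stub_ROOF0`; head destructures one more component.  WHY: the (rL) `w`-block of `Roof₀` reads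
`𝔠_w = 𝔭_w^{v_w(𝔞_γ) − 1}` and needs `v_w(𝔞_γ) = e_w f_w = ord_w (q)`; from v4's binders (`_hdiv _hnorm _hcov _hpin`) this is TRUE but only through a DEGREE COUNT on the cover
((f3) `deg c̄ ² · deg λ = deg λ' · q^{2 dim}` + `|A[𝔞]| = N𝔞²` + (π1) + (π2-G)) — an M–L organ nobody holds; with `_hspec` it is ★ p847749 `count_eq_count_span_of_not_le_complexConj_smul`
(LA3-p03) applied to (`_hspec γ`, `_hpin….1`, `_hnorm`) — XS.  M-51 pattern: export what the constructor knows.  Namespace `…F0P6aStubFROBv4b` (HOME-only; nothing registered).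
HC_CM is proved only modulo the 7 printed citations (2 remaining: hLiu418 = stmt-HodgeConjecture-24832, h413 = 24833) until rung 0 closes; count-neutral.

(A-p03's v4 header follows.)

# D-LINE socket `stub_FROB` — CLOSER SKELETON v4 = «v3-PIN» ADOPTED (HOME-only; pen of record A-p03 (g30), (π) row tokens by co-pen LA3-plan (g0); LEAD «M-57» (1) 02:07:47Z BINDING)

LEAD «M-57»: the v2 cut {`stub_TWISTCOVER0` (twist data EXISTENTIAL), `stub_ROOF0`} with THE PIN THREADED THROUGH THE ∃ — `stub_TWISTCOVER0` OUTPUTS, and `stub_ROOF0` takes as `_hpin`,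
the guarded pair (π1) `𝔞 γ ⊔ 𝔭_{c•w} = ⊤` + (π2-G) the GEOMETRIC banal-block Frobenius-kernel law (`FrobPin₀ I (𝔞 γ)`, LA3-plan memo «Q-ROOF-α» 819cf5b7 §3 tokens); the arithmetic
F-PIN-can of my v3 6e8f16cc is NOT a spine field (derivable; M-57 (2)) — v3 WITHDRAWN as line of record, this file (= LA3-plan `…v3pin…` cf06b969 byte-identical below the header, in
the pen's namespace `…F0P6aStubFROB`) IS the line.  Spine ED. 4 rows of record («M-58», GEN pen): (B-1) `m_banal`, `m_pair`, (π1) `twistIdeal_coprime_conj`, (π2-G) `frobKernel_banal` —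
so the eventual proof of `stub_TWISTCOVER0` is `⟨I.twistIdeal, I.twistNorm, I.twistIdeal_coprime, I.twistIdeal_ne_bot, I.twistIdeal_frob, I.twistNorm_frob, ROAD-A cover
(★ (ν8)∕(ν8d) p847636∕p847682 + ★ p847680 + ★ (d1)(d2) + ★ p847713), fun … => ⟨I.twistIdeal_coprime_conj …, I.frobKernel_banal …⟩⟩`, and `stub_ROOF0` = (r-B) + ★ (ν8) legs +
★ α2a + the (rL) leaf whose banal section READS `_hpin.2` and whose `c•w`∕`w` sections read the dock + (B-1).
HC_CM is proved only modulo the 2 remaining named inputs (hLiu418 24832, h413 24833) until rung 0 closes; HOME-only, nothing registered, count-neutral.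

(LA3-plan's original header follows.)

# D-LINE socket `stub_FROB` — CLOSER SKELETON «v3-PIN» (HOME-only; LA3-plan (g0) CO-PEN PROPOSAL over A-p03 (g30) v2 abd00c75602e5429; A-p03's tokens win, LEAD rules)

= A-p03 v2 VERBATIM (the cut {`stub_TWISTCOVER0`, `stub_ROOF0`}, head `stubFROB_of_parts`, junction `example`) + ONE GUARDED PIN ROW (memo «Q-ROOF-α»
`F0/P6/L3/LA3-plan/g0/MEMO-Q-ROOF-alpha.v1.LA3-plan-g0.md` 819cf5b74137416c): `(π) GUARD(σ,γ) → FrobPin₀ I (𝔞 γ)` is an OUTPUT conjunct of `stub_TWISTCOVER0` and an INPUT `_hpin` of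
`stub_ROOF0`, because v2's `(_hdiv, _hnorm, _hcov)` are invariant under the unit-group transfer `(𝔞, c̄) ↦ (𝔞·(α), c̄ ∘ ι(α))`, `α ∈ U_N = {αᾱ = 1, α ≡ 1 (mod N), (α) over p}`, while (rL) of
`Roof₀` forces `v_{c•w}(𝔞γ·𝔭_w⁻¹) = 0` (order count on the dock `G₀`: rank `q²` vs `kerF` rank `q`) and the banal exponents.  `FrobPin₀ I 𝔞` = (π1) `𝔞 ⊔ 𝔭_{c•w} = ⊤` ∧ (π2-G) the
BANAL-BLOCK FROBENIUS-KERNEL LAW «at every `red₀ y`, for every `u ∣ p`, `u ∉ {w, c•w}`, on `u`-primary `T`-points: `t ≫ F_q = 1 ↔ t ∈ A[𝔞]`» (the banal third of (rL), moved to the twist side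
where print pays it: Shimura–Taniyama for the frame CM object behind door (E) — ROAD A source = spine ED. 4 «F-PIN⁺»; ROAD B source = the canonical ideal `𝔭_w^{e f}·∏ 𝔭_u^{k_u(m)}`).
Namespace `…F0P6aStubFROBPin` (distinct from A-p03's `…F0P6aStubFROB`; same decl names + one row, so the diff is the row).  Imports = the served D-line ED. 1 only.
HC_CM is proved only modulo the 7 printed citations (2 remaining: hLiu418 = stmt-HodgeConjecture-24832, h413 = stmt-HodgeConjecture-24833) until rung 0 closes; HOME-only, nothing registered, count-neutral.
-/

set_option autoImplicit false
set_option linter.dupNamespace false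

noncomputable section

namespace Summit.HodgeConjecture.HodgeConjecture.Cruxes.HLiu418.F0P6aStubFROB

open CategoryTheory CategoryTheory.Limits NumberField IsDedekindDomain MulAction
open scoped Matrix Polynomial Pointwise MonoidalCategory
open Literature.NumberTheory.GaloisRepresentations
open Literature.NumberTheory.Automorphic Literature.NumberTheory.Automorphic.UnitaryGroup
open Literature.AlgebraicGeometry.ShimuraVarieties.UnitaryCanonicalModel
open Literature.NumberTheory.Automorphic.Liu2021.AppendixC
open Literature.AlgebraicGeometry.Motives (AlgPoints IntegralModel SchemeOver thickening thickeningGalAction thickeningLift specOver relFrobeniusOver frobeniusTwistOver frobSpec)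
open Literature.NumberTheory.DiophantineGeometry (geomResidueField specialFibreFunctor specResidueField)
open Literature.AlgebraicGeometry.RelativeSpec (ActionOver)
open Literature.NumberTheory.EllipticCurves (genericFibre)
open Summit.HodgeConjecture.HodgeConjecture.Cruxes.HLiu418.F0P6aModuliDatumDefs
open Summit.HodgeConjecture.HodgeConjecture.Cruxes.HLiu418.F0P6aRGDAssembly
open Summit.HodgeConjecture.HodgeConjecture.Cruxes.HLiu418.F0P6aDatumOfInputs
open Summit.HodgeConjecture.HodgeConjecture.Cruxes.HLiu418.F0P6aLineSpecialisation (spGeoOf canonicalLine_spGeoOf natCard_lineOf_eq_succ)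

section CoIdeal

/-- The FROBENIUS CO-IDEAL `𝔠(γ) := 𝔞_γ 𝔭_w⁻¹` as an INTEGRAL ideal: the cofactor of `𝔭_w` in `𝔞_γ` when `𝔭_w ∣ 𝔞_γ` (Dedekind: `∣` is `∃ 𝔠, 𝔞 = 𝔭𝔠`), and `⊤` otherwise
(the `FrobReading₀` guard only ever asks at a Frobenius-reading `γ`, where `𝔭_w ∣ 𝔞_γ`). [cite: Shimura1998, §13.1 Thm. 1 (pp. 97–99)] -/
def frobIdealOf {F : Type} [Field F] [NumberField F] {Fi : Type} [Field Fi] [Algebra F Fi]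
    (𝔞 : (Fi ≃ₐ[F] Fi) → Ideal (𝓞 F)) (w : HeightOneSpectrum (𝓞 F)) : (Fi ≃ₐ[F] Fi) → Ideal (𝓞 F) :=
  fun γ => by
    classical
    exact if h : w.asIdeal ∣ 𝔞 γ then Classical.choose h else ⊤

/-- `𝔠(γ) · 𝔭_w = 𝔞_γ` whenever `𝔭_w ∣ 𝔞_γ`. [cite: Shimura1998, §13.1 Thm. 1 (pp. 97–99)] -/
theorem frobIdealOf_mul_eq {F : Type} [Field F] [NumberField F] {Fi : Type} [Field Fi] [Algebra F Fi]
    (𝔞 : (Fi ≃ₐ[F] Fi) → Ideal (𝓞 F)) (w : HeightOneSpectrum (𝓞 F)) {γ : Fi ≃ₐ[F] Fi}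
    (h : w.asIdeal ∣ 𝔞 γ) : frobIdealOf 𝔞 w γ * w.asIdeal = 𝔞 γ := by
  classical
  simp only [frobIdealOf, dif_pos h]
  rw [mul_comm]
  exact (Classical.choose_spec h).symm

end CoIdeal

section Stubs

-- the frame of the tree՚s `Stubs` section VERBATIM (incl. the (rL) guard instances `[IsGalois ℚ F] [FiniteDimensional F Fi] [IsGalois F Fi] [Finite G]`)
variable {F : Type} [Field F] [NumberField F] [IsCMField F] [IsGalois ℚ F] {ι₁ : F →+* ℂ}
    {Jstar : Matrix (Fin 2) (Fin 2) F}
    {K₀ : C5.OpenCompactSubgroup ↥(finAdelic ↥(maximalRealSubfield F) F (IsCMField.complexConj F) 2 Jstar)}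
    {S : RecordSystemGS F Jstar ι₁ K₀} {hU7ₛ : S.HeckeTranslateDefinedOver}
    {hJ : (Jstar.map (IsCMField.complexConj F))ᵀ = Jstar} {hJu : IsUnit Jstar}
    {Fi : Type} [Field Fi] [Algebra F Fi] [FiniteDimensional F Fi] [IsGalois F Fi] {Kc : C5.SmallLevel K₀} {G : Type} [Group G] [Finite G]
    {𝓜 : IntegralModel (𝓞 F) F ((thickening F Fi).obj (S.M.obj Kc))}
    {w : HeightOneSpectrum (𝓞 F)} {hw : (IsCMField.complexConj F) • w ≠ w} {h𝓨 : (𝓜.localise w).IsSmoothProper 1}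
    {θ : ActionOver (𝓜.localise w).total.hom ((Fi ≃ₐ[F] Fi) × G)}
    {e : Fi →ₐ[F] AlgebraicClosure (w.adicCompletion F)}

set_option maxHeartbeats 400000 in
open scoped MonObj Obj in
/-- (π) **`FrobPin₀ I 𝔞` — THE FROBENIUS PIN OF A TWIST IDEAL** (memo «Q-ROOF-α» §4): (π1) `𝔞` is prime to `𝔭_{c•w}` («on the `c•w`-block the co-ideal is a unit», the (rL) block
reading of Defs `Roof₀`); (π2-G) THE BANAL-BLOCK FROBENIUS-KERNEL LAW at every reduction `x̄ = red₀ y`: for every place `u ∣ p` off the pair `{w, c•w}` and every `u`-primary `T`-point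
`t` of `A_x̄` (killed by some `𝔭_u^n`), `t ≫ F_q = 1 ↔ ∀ a ∈ 𝔞, t ≫ ι(a) = 1` — Shimura–Taniyama on the banal blocks (`Ker F_q ∩ A[u^∞] = A[𝔭_u^{k_u}]`, `k_u = #{τ ~ u : m τ = 2}` for
`p` unramified), tokens = the (rL) clause of `Roof₀` with `q̄` dropped (banal blocks meet `Ker q̄` trivially).  TRUE for the canonical twist ideal of a Frobenius reading; FALSE for its
`U_N`-transfers; exactly what `stub_ROOF0`'s (rL) needs beyond the cover's local norm equation `v_u(𝔞) + v_{c•u}(𝔞) = e_u f_w`.  NOT asserted by declaring it.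
[cite: Shimura1998, §13.1 Thm. 1 (pp. 97–99); §18.6 (p. 127)] [cite: Liu2021, Prop. D.8 (3) p. 135, pp. 136–138] [cite: Kottwitz1992, §5 (p. 391)] -/
def FrobPin₀ (I : RGDInputsAt F ι₁ Jstar K₀ S hU7ₛ hJ hJu Fi Kc G 𝓜 w hw h𝓨 θ e) [ExpChar (geomResidueField w) I.pChar] (𝔞 : Ideal (𝓞 F)) : Prop :=
  -- (π1) prime to `𝔭_{c•w}`
  𝔞 ⊔ (((IsCMField.complexConj F) • w).asIdeal : Ideal (𝓞 F)) = ⊤ ∧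
  -- (π2-G) the banal-block Frobenius-kernel law at every reduction `red₀ y` — BY NAME (spine ED. 4 `FrobKernelBanal₀`; v4b's inline text is its body)
  FrobKernelBanal₀ S Kc 𝓜 w h𝓨 e I.univ I.act I.pChar I.fDeg 𝔞

/-! #### §CanonicalLine — glue for the v5 split of `stub_ROOF0` (D-line currency; HOME rehearsal) -/

-- (K6 ★ twin — gate `dedup.landed`, dealer LA3-plan (g5)): the tree's LOCAL copy of `two_le_pChar_pow_fDeg` (14 l. incl. docstring)
-- is DELETED here; the landed ★ `Summit.HodgeConjecture.HodgeConjecture.Cruxes.HLiu418.F0P6aLineSpecialisation.two_le_pChar_pow_fDeg`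
-- (`Theorems/F0P6aLineSpecialisationLayer.lean`, p852966; section WITHOUT `[IsGalois ℚ F]`, so more general) is cited by FQN at its use sites below.  Every other byte = tree ED. of record.

-- [d″] (LA3-r01 (g8) #66): the local `eq_kerFOf_or_isEtaleOf` (DICHOTOMY AT THE DOCK, 19 l. incl. `omit`/docstring) is DELETED here — it restates the
-- importable ★ twin `…F0P6aLineSpecialisation.eq_kerFOf_or_isEtaleOf` (`Theorems/F0P6aLineSpecialisationLaws.lean` :323, LS PART 5, same 10 proof lines, type = this
-- copy's type minus the auto-included `[IsGalois ℚ F]` binder ⇒ strictly more general); its one call site below (`canSP_of_laws`) is respelled to that ★ FQN.  [cite: Tate1997FiniteFlatGroupSchemes, (3.7)]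

omit [FiniteDimensional F Fi] [IsGalois F Fi] [Finite G] in
/-- **THE ÉTALE MEMBER OF `SubOf I 𝔡 x̄` IS UNIQUE** (★ p848314 §2 `subtype_eq_of_etale_of_natCard_sections_eq_one_or` at `(𝔡 x̄).G₀` with the dock row `hpts₀ : #G₀(κ̄) ∈ {1, q}` and the
corank-`q` clause of `IsAdm`).  The `hEt` feed of ★ p848314. [cite: Tate1997FiniteFlatGroupSchemes, (3.7)] [cite: StacksProject, Tag 00U3] -/
theorem subOf_eq_of_isEtaleOf (I : RGDInputsAt F ι₁ Jstar K₀ S hU7ₛ hJ hJu Fi Kc G 𝓜 w hw h𝓨 θ e) [ExpChar (geomResidueField w) I.pChar]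
    (𝔡 : ∀ xbar, DockAt I xbar) (xbar : AlgPoints (𝓜.localise w).reductionAt (geomResidueField w)) (H H' : SubOf I 𝔡 xbar)
    (hH : IsEtaleOf I 𝔡 H) (hH' : IsEtaleOf I 𝔡 H') : H = H' := by
  letI := (𝔡 xbar).grp₀
  haveI := (𝔡 xbar).aff₀
  haveI := (𝔡 xbar).fin₀
  exact Summit.HodgeConjecture.HodgeConjecture.Theorems.F0P6aCanonicalLineTransfer.subtype_eq_of_etale_of_natCard_sections_eq_one_or
    (𝔡 xbar).G₀ (Summit.HodgeConjecture.HodgeConjecture.Cruxes.HLiu418.F0P6aLineSpecialisation.two_le_pChar_pow_fDeg I) (𝔡 xbar).hpts₀ (fun _ hJ => hJ.2.1) H H' hH hH'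

omit [FiniteDimensional F Fi] [IsGalois F Fi] [Finite G] in
set_option maxHeartbeats 400000 in
/-- **REHEARSAL `canSP_of_laws` — THE CANONICAL-LINE TRANSFER `stub_CANSP` WITH L2'S THREE FEEDS AS BINDERS** (LS leaflet `Lines/F0_P6a_LineSpecialisation.lean`, LA2-plan
02:54:37Z: §1 `spGeoOf` + `canonicalLine_spGeoOf` = `hcan₂`, §3 `red₀Of_quotΩ_eq_of_spGeoOf_eq` = `hwd₂`, §2 `natCard_lineOf_eq_succ` = `hcardL`): for every reading `𝔯` and
every line `L` with `𝔯.spec.sp y L = kerFOf …` there is a GEOMETRICALLY canonical `L′` (`spGeo y L′ = kerFOf …`) with the SAME quotient reduction `red₀ (quotΩ y L′) = red₀ (quotΩ y L)`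
— ONE call of ★ p848314 `canonicalLine_transfer_of_red_quotΩ` at `red := red₀Of …`, `Line := LineOf I`, `Sub := SubOf I 𝔡`, `kerF := kerFOf I 𝔡`, `IsEtale := IsEtaleOf I 𝔡`,
`sp₁ := 𝔯.spec.sp`, `quot₀ := 𝔯.spec.quot`, `hred_quotΩ := 𝔯.spec.red_quotΩ`, `hcan₁ := 𝔯.spec.canonicalLine₀`, `hdich := eq_kerFOf_or_isEtaleOf`, `hEt := subOf_eq_of_isEtaleOf`,
`hthree := exists_ne_ne_of_natCard_eq_succ`. [cite: Liu2021, Prop. D.8 (3) p. 135, pp. 137–138] [cite: Carayol1986Compositio, §10.3 Prop. p. 211] -/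
theorem canSP_of_laws (I : RGDInputsAt F ι₁ Jstar K₀ S hU7ₛ hJ hJu Fi Kc G 𝓜 w hw h𝓨 θ e) [ExpChar (geomResidueField w) I.pChar]
    (𝔡 : ∀ xbar, DockAt I xbar)
    (quotΩ : ∀ y, LineOf I y → AlgPoints (S.M.obj Kc) (AlgebraicClosure (w.adicCompletion F)))
    (translΩ : AlgPoints (S.M.obj Kc) (AlgebraicClosure (w.adicCompletion F)) → AlgPoints (S.M.obj Kc) (AlgebraicClosure (w.adicCompletion F)))
    (𝔯 : DownReadings I 𝔡 quotΩ translΩ)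
    -- L2's feeds (LS leaflet): the geometric specialisation reading, its canonical line, its quotient law, the line count
    (spGeo : ∀ y, LineOf I y → SubOf I 𝔡 (red₀Of S Kc 𝓜 w h𝓨 e y))
    (hcan₂ : ∀ y, (∃ H : SubOf I 𝔡 (red₀Of S Kc 𝓜 w h𝓨 e y), IsEtaleOf I 𝔡 H) →
      ∃ L₀ : LineOf I y, spGeo y L₀ = kerFOf I 𝔡 (red₀Of S Kc 𝓜 w h𝓨 e y) ∧ ∀ L : LineOf I y, spGeo y L = kerFOf I 𝔡 (red₀Of S Kc 𝓜 w h𝓨 e y) → L = L₀)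
    (hwd₂ : ∀ y (L L' : LineOf I y), spGeo y L = spGeo y L' → red₀Of S Kc 𝓜 w h𝓨 e (quotΩ y L) = red₀Of S Kc 𝓜 w h𝓨 e (quotΩ y L'))
    (hcardL : ∀ y, Nat.card (LineOf I y) = I.pChar ^ I.fDeg + 1)
    (y : AlgPoints (S.M.obj Kc) (AlgebraicClosure (w.adicCompletion F))) (L : LineOf I y)
    (hsp : 𝔯.spec.sp y L = kerFOf I 𝔡 (red₀Of S Kc 𝓜 w h𝓨 e y)) :
    ∃ L' : LineOf I y, spGeo y L' = kerFOf I 𝔡 (red₀Of S Kc 𝓜 w h𝓨 e y) ∧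
      red₀Of S Kc 𝓜 w h𝓨 e (quotΩ y L') = red₀Of S Kc 𝓜 w h𝓨 e (quotΩ y L) :=
  Summit.HodgeConjecture.HodgeConjecture.Theorems.F0P6aCanonicalLineTransfer.canonicalLine_transfer_of_red_quotΩ
    (red₀Of S Kc 𝓜 w h𝓨 e) (LineOf I) (SubOf I 𝔡) (kerFOf I 𝔡) (fun {xbar} (H : SubOf I 𝔡 xbar) => IsEtaleOf I 𝔡 H) quotΩ 𝔯.spec.sp spGeo
    𝔯.spec.quot 𝔯.spec.red_quotΩ (Summit.HodgeConjecture.HodgeConjecture.Cruxes.HLiu418.F0P6aLineSpecialisation.eq_kerFOf_or_isEtaleOf I 𝔡) (subOf_eq_of_isEtaleOf I 𝔡) 𝔯.spec.canonicalLine₀ hcan₂ hwd₂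
    (Summit.HodgeConjecture.HodgeConjecture.Theorems.F0P6aCanonicalLineTransfer.exists_ne_ne_of_natCard_eq_succ (LineOf I)
      (Summit.HodgeConjecture.HodgeConjecture.Cruxes.HLiu418.F0P6aLineSpecialisation.two_le_pChar_pow_fDeg I) hcardL) y L hsp

set_option maxHeartbeats 400000 in
set_option linter.unusedSectionVars false in  -- ED. 2: the three `Stubs`-section instances `[FiniteDimensional F Fi] [IsGalois F Fi] [Finite G]` stay IN the Π-type exactly as in ED. 1 (type byte-frozen; the leaflet `omit`s them), unused by the term proof
/-- (COV₀) [ED. 2: PAID — `F0P6aStubFROBCover.cov0_of_inputs I`, COV0 Lines leaflet ED. 1; statement byte-frozen] **THE FROBENIUS COVER DOWNSTAIRS FOR THE SPINE'S TWIST DATA** — the (cov) conjunct of `stub_TWISTCOVER0` ALONE, at `(𝔞, 𝔫) := (I.twistIdeal, I.twistNorm)`: at every `γ`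
reading an arithmetic Frobenius `σ` on the sheet `e`, `FrobCover₀ … (I.twistIdeal γ) (I.twistNorm γ) (red₀ (σ • y)) (red₀ y)` for all `y`.  TRUE for every inhabitant `I` (a theorem
of its rows, no «∀ I» hazard): destructure row 40 `I.coverKerΩ e γ (σ • y)` (`CoverKerΩ`, kernel clause (t1′) in T-form), surjectivity from (t1), `hx″` from ★ p847680, then ★ (ν8d) +
★ LA3-p02 `exists_frobCover_specialFibre` (file II over ★ p848420 `FrobeniusCoverRecognition`) + the tail `StubFROBCoverTail` 62785934 into `FrobCover₀`.  ROAD A of record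
(LEAD «M-54»∕«M-57»); payer LA3-p02 (g0) (LA3-plan co-pen v5a 97185995 (2), DEAL v4). [cite: SerreTate1968, Thm 1, Cor. 2] [cite: Shimura1998, §13.1 Thm. 1 (pp. 97–99); §18.6 (p. 127)]
[cite: Liu2021, Prop. D.8 (3) p. 135, pp. 136–138] -/
theorem stub_COV0 (I : RGDInputsAt F ι₁ Jstar K₀ S hU7ₛ hJ hJu Fi Kc G 𝓜 w hw h𝓨 θ e) [ExpChar (geomResidueField w) I.pChar] :
    ∀ (σ : Field.absoluteGaloisGroup (w.adicCompletion F)), IsAbsArithFrob σ → ∀ γ : Fi ≃ₐ[F] Fi,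
      ((AlgEquiv.restrictScalars F (Field.absoluteGaloisGroup.toAlgEquiv (w.adicCompletion F) σ) :
          AlgebraicClosure (w.adicCompletion F) ≃ₐ[F] AlgebraicClosure (w.adicCompletion F)) :
          AlgebraicClosure (w.adicCompletion F) →ₐ[F] AlgebraicClosure (w.adicCompletion F)).comp e = e.comp (γ : Fi →ₐ[F] Fi) →
      ∀ y : AlgPoints (S.M.obj Kc) (AlgebraicClosure (w.adicCompletion F)),
        FrobCover₀ 𝓜 w I.univ I.act I.dual I.pol I.lvl I.pChar I.fDeg (I.twistIdeal γ) (I.twistNorm γ)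
          (red₀Of S Kc 𝓜 w h𝓨 e (σ • y)) (red₀Of S Kc 𝓜 w h𝓨 e y) :=
  -- ED. 2: PAID by the COV0 Lines leaflet ED. 1 (road (δ); ★ (ν8k) p849382 seam) — statement above byte-frozen, `γ` there spelled `gam`.
  Summit.HodgeConjecture.HodgeConjecture.Cruxes.HLiu418.F0P6aStubFROBCover.cov0_of_inputs I

set_option maxHeartbeats 400000 in
/-- (TWIST + COVER₀ + PIN) [v5: a THEOREM over spine ED. 4 + `stub_COV0`; statement = v4b verbatim] **THE CANONICAL TWIST DATA WITH THEIR FROBENIUS COVER** — twist ideals `𝔞_γ` and norms `n_γ`, prime to the level, nonzero, with `𝔭_w ∣ 𝔞_γ` and `n_γ = q` at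
every `γ` reading an arithmetic Frobenius `σ` on the sheet `e`, and the Frobenius cover `FrobCover₀ … (𝔞_γ) (n_γ) (red₀ (σ • y)) (red₀ y)` there.  ROAD A (spine ED. 3 + «F-PIN»):
`I.twistIdeal`, `I.twistNorm` + reduction of (L5) `I.coverΩ e γ (σ • y)` by ★ (ν8) p847636 at `(ℓ_e(σ•y), σ(ℓ_e y))`, ★ `geomReductionMap_smul_of_isAbsArithFrob`, ★ (d1)(d2) Frobenius
twist of the fibre (`θ`-free); ROAD B (M-54): produce the canonical `𝔞_γ` (signature `I.m`, Shimura–Taniyama). [cite: Shimura1998, §13.1 Thm. 1 (pp. 97–99); §18.6 (p. 127)]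
[cite: SerreTate1968, Thm 1, Cor. 2] -/
theorem stub_TWISTCOVER0 (I : RGDInputsAt F ι₁ Jstar K₀ S hU7ₛ hJ hJu Fi Kc G 𝓜 w hw h𝓨 θ e) [ExpChar (geomResidueField w) I.pChar]
    (𝔡 : ∀ xbar, DockAt I xbar)
    (quotΩ : ∀ y, LineOf I y → AlgPoints (S.M.obj Kc) (AlgebraicClosure (w.adicCompletion F)))
    (translΩ : AlgPoints (S.M.obj Kc) (AlgebraicClosure (w.adicCompletion F)) → AlgPoints (S.M.obj Kc) (AlgebraicClosure (w.adicCompletion F)))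
    (_hhecke : HeckeClause I quotΩ translΩ) (_hroof : RoofLink I quotΩ) (_hroof₂ : RoofLink₂ I translΩ) (_𝔯 : DownReadings I 𝔡 quotΩ translΩ)
    (_hunit : (UnitaryGroup.isUnit_placeForm Jstar hJu w).unit ∈ glInt 2 (w.adicCompletion F))
    (_hKc : UnitaryGroup.IsHyperspecialAt ↥(maximalRealSubfield F) F (IsCMField.complexConj F) 2 Jstar Kc.1.1
      (w.under (𝓞 ↥(maximalRealSubfield F))))
    (_hdisj : haveI : AlgebraicGeometry.IsProper (𝓜.localise w).total.hom := h𝓨.2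
      ∀ (β : Fi ≃ₐ[F] Fi) (P Q : AlgPoints (S.M.obj Kc) (AlgebraicClosure (w.adicCompletion F))),
        (𝓜.localise w).geomReductionMap (thickeningLift e (S.M.obj Kc) P) =
          AlgPoints.map ((specialFibreFunctor w).map (Over.isoMk (θ.aut (β, 1)) (θ.aut_comp (β, 1))).hom :
              (𝓜.localise w).reductionAt ⟶ (𝓜.localise w).reductionAt)
            ((𝓜.localise w).geomReductionMap (thickeningLift e (S.M.obj Kc) Q)) → β = 1) :
    ∃ (𝔞 : (Fi ≃ₐ[F] Fi) → Ideal (𝓞 F)) (𝔫 : (Fi ≃ₐ[F] Fi) → ℕ),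
      (∀ γ : Fi ≃ₐ[F] Fi, 𝔞 γ ⊔ Ideal.span {((I.N : ℕ) : 𝓞 F)} = ⊤) ∧
      (∀ γ : Fi ≃ₐ[F] Fi, 𝔞 γ ≠ ⊥) ∧
      (∀ (σ : Field.absoluteGaloisGroup (w.adicCompletion F)), IsAbsArithFrob σ → ∀ γ : Fi ≃ₐ[F] Fi,
        ((AlgEquiv.restrictScalars F (Field.absoluteGaloisGroup.toAlgEquiv (w.adicCompletion F) σ) :
            AlgebraicClosure (w.adicCompletion F) ≃ₐ[F] AlgebraicClosure (w.adicCompletion F)) :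
            AlgebraicClosure (w.adicCompletion F) →ₐ[F] AlgebraicClosure (w.adicCompletion F)).comp e = e.comp (γ : Fi →ₐ[F] Fi) →
        w.asIdeal ∣ 𝔞 γ) ∧
      (∀ (σ : Field.absoluteGaloisGroup (w.adicCompletion F)), IsAbsArithFrob σ → ∀ γ : Fi ≃ₐ[F] Fi,
        ((AlgEquiv.restrictScalars F (Field.absoluteGaloisGroup.toAlgEquiv (w.adicCompletion F) σ) :
            AlgebraicClosure (w.adicCompletion F) ≃ₐ[F] AlgebraicClosure (w.adicCompletion F)) :
            AlgebraicClosure (w.adicCompletion F) →ₐ[F] AlgebraicClosure (w.adicCompletion F)).comp e = e.comp (γ : Fi →ₐ[F] Fi) →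
        𝔫 γ = I.pChar ^ I.fDeg) ∧
      (∀ (σ : Field.absoluteGaloisGroup (w.adicCompletion F)), IsAbsArithFrob σ → ∀ γ : Fi ≃ₐ[F] Fi,
        ((AlgEquiv.restrictScalars F (Field.absoluteGaloisGroup.toAlgEquiv (w.adicCompletion F) σ) :
            AlgebraicClosure (w.adicCompletion F) ≃ₐ[F] AlgebraicClosure (w.adicCompletion F)) :
            AlgebraicClosure (w.adicCompletion F) →ₐ[F] AlgebraicClosure (w.adicCompletion F)).comp e = e.comp (γ : Fi →ₐ[F] Fi) →
        ∀ y : AlgPoints (S.M.obj Kc) (AlgebraicClosure (w.adicCompletion F)),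
          FrobCover₀ 𝓜 w I.univ I.act I.dual I.pol I.lvl I.pChar I.fDeg (𝔞 γ) (𝔫 γ)
            (red₀Of S Kc 𝓜 w h𝓨 e (σ • y)) (red₀Of S Kc 𝓜 w h𝓨 e y)) ∧
      (∀ (σ : Field.absoluteGaloisGroup (w.adicCompletion F)), IsAbsArithFrob σ → ∀ γ : Fi ≃ₐ[F] Fi,
        ((AlgEquiv.restrictScalars F (Field.absoluteGaloisGroup.toAlgEquiv (w.adicCompletion F) σ) :
            AlgebraicClosure (w.adicCompletion F) ≃ₐ[F] AlgebraicClosure (w.adicCompletion F)) :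
            AlgebraicClosure (w.adicCompletion F) →ₐ[F] AlgebraicClosure (w.adicCompletion F)).comp e = e.comp (γ : Fi →ₐ[F] Fi) →
        FrobPin₀ I (𝔞 γ)) ∧
      -- (ns) THE NORM EQUATION of the twist data (spine ED. 3 `twistNorm_spec` by projection; v4b, LA3-plan «Q-ROOF-w»)
      (∀ γ : Fi ≃ₐ[F] Fi, Ideal.span {((𝔫 γ : ℕ) : 𝓞 F)} = 𝔞 γ * (IsCMField.complexConj F) • 𝔞 γ) :=
  -- v5: PAID from spine ED. 4 rows (`twistIdeal_coprime`, `twistIdeal_ne_bot`, `twistIdeal_frob`, `twistNorm_frob`, (π1) `twistIdeal_coprime_conj`, (π2-G) `frobKernel_banal`,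
  -- (ns) `twistNorm_spec`) + the residual socket `stub_COV0` (cov) — LA3-plan v5a 97185995 (3)
  ⟨I.twistIdeal, I.twistNorm, I.twistIdeal_coprime, I.twistIdeal_ne_bot, I.twistIdeal_frob, I.twistNorm_frob, stub_COV0 I,
    fun σ hσ γ hγ => ⟨I.twistIdeal_coprime_conj σ hσ γ hγ, I.frobKernel_banal σ hσ γ hγ⟩, I.twistNorm_spec⟩


/-! (★ re-home, size lint + «M-150j» early split: PART 1 of 3 ends here at tree line :300; the workfile continues, in the same namespace, in `Theorems/F0P6aStubFROBCanSP.lean`.) -/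

end Stubs
end Summit.HodgeConjecture.HodgeConjecture.Cruxes.HLiu418.F0P6aStubFROB
end
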